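import Summits.Ventures.GridStability.Models.Kundur2ASplitLurieLines
import Summits.Ventures.GridStability.Bench.WSCC9LossySplitSlabRoa
import HarnessLib

/-!
# GridStability/Lyapunov/K2ALossySplitLinesCast — the UNORDERED-LINES split object `Kundur2A.splitLurieLinesSystem`
# (★ #22's lossy two-area four-machine model, `λ = 1/10`) as casts of rational matrices + the wide-window sine
# sector lemma («G2.c-K2A-SPLITU», object file)

Cell `gridfusion` (LADDER-GRIDFUSION G2.c lossy Lur'e tier, Kundur-two-area rung); seat gridfusion-lit-6 (g10).  The K2A
twin of lyap-2's `WSCC9LossySplitSlabCast` §«index flattenings / the object's matrices» and lit-6 g9's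
`WSCC9LossySplitLinesCast` §«the new input matrix»: index flattenings `e1 : Fin 4 ⊕ Fin 3 ≃ Fin 7`,
`eκ : (Fin 4 × Fin 4) ⊕ (Fin 4 × Fin 4) ≃ Fin 32` (sine `(p,q) ↦ 4p+q`, cosine `↦ 16+4p+q`), `e2` (`≃ Fin 39`); the
object's matrices over `ℚ` — `AQ` (`−1/10` on the speed diagonal = the declared uniform damping ratio, `refT`),
`lineInputQ` / `BLQ = [lineInputQ; 0]` (sine line `(p,q)`, `p < q`: `+K^B_pq` in row `p`, `−K^B_qp` in row `q`; cosine
line `+K^G_pq`, `+K^G_qp`; unit inertias), `CQ = [0 | pairIncidence; pairIncidence]` — and the identities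
`A_eq / B_eq / C_eq` with `S = Kundur2A.splitLurieLinesSystem` (`Models/Kundur2ASplitLurieLines.lean`, p581098).
Plus `sector_sin_of_values_wide`: the closed-form sector lemma for a sine line whose equilibrium angle is SMALLER
than the window (`b = 1`; lit-6's `channel_sector_sin`), companion of lyap-2's narrow-window `sector_sin_of_values`
— the two-area record has two such lines (`(0,2)`, `(1,3)`: `|δ*| ≈ 0.22°, 0.12°`).
THREE COLUMNS.  CERTIFIED: nothing (identities).  MODELLED: as `Models/Kundur2ASplitLurieLines` / ★ #22.  VALIDATED:
nothing.  No sentence of this file says a grid is stable.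
[cite: Pai1981, §3.6.3 eqs. (3.43)–(3.45), §4.6 p. 117; VuTuritsyn2017, §4.1]
-/

noncomputable section

open Real Matrix
open Literature.MathematicalPhysics.PowerSystems
open Literature.MathematicalPhysics.PowerSystems.LyapunovFunctionFamily
open Summit.Ventures.GridStability.Models

namespace Summit.Ventures.GridStability.Lyapunov.K2ALossySplitLines

/-! ### Index flattenings (the producer's conventions) -/

/-- States `Fin 4 ⊕ Fin 3 ≃ Fin 7` (`ω₀, ω₁, ω₂, ω₃, σ₁, σ₂, σ₃`). -/
def e1 : Fin 4 ⊕ Fin 3 ≃ Fin 7 := finSumFinEquiv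

/-- Channels `(Fin 4 × Fin 4) ⊕ (Fin 4 × Fin 4) ≃ Fin 32`: sine `(p, q) ↦ 4p + q`, cosine `(p, q) ↦ 16 + 4p + q`. -/
def eκ : (Fin 4 × Fin 4) ⊕ (Fin 4 × Fin 4) ≃ Fin 32 :=
  (Equiv.sumCongr finProdFinEquiv finProdFinEquiv).trans finSumFinEquiv

/-- Certificate-matrix index `(Fin 4 ⊕ Fin 3) ⊕ ((Fin 4 × Fin 4) ⊕ (Fin 4 × Fin 4)) ≃ Fin 39`. -/
def e2 : (Fin 4 ⊕ Fin 3) ⊕ ((Fin 4 × Fin 4) ⊕ (Fin 4 × Fin 4)) ≃ Fin 39 := (Equiv.sumCongr e1 eκ).trans finSumFinEquiv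

/-! ### The object's matrices over `ℚ` -/

/-- `1/M_i` over `ℚ` (unit inertias in scaled time: `= 1`). -/
def MinvQ (i : Fin 4) : ℚ := 1 / Kundur2A.csgPre.M i

/-- `A = [[−diag(λ), 0], [refT, 0]]` over `ℚ`, `λ = 1/10`. -/
def AQ : Matrix (Fin 4 ⊕ Fin 3) (Fin 4 ⊕ Fin 3) ℚ :=
  Matrix.fromBlocks (-Matrix.diagonal (fun _ => (1 : ℚ) / 10)) 0
    (Matrix.of fun a i => (if i = a.succ then 1 else 0) - (if i = 0 then 1 else 0)) 0

/-- `lineInput` over `ℚ`: sine line `(p,q)`, `p < q`: `+C_pq/M_p` in row `p`, `−C_qp/M_q` in row `q`; cosine line: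
`+D_pq/M_p` and `+D_qp/M_q`; columns with `p ≥ q` zero (lit-6's definition verbatim over `ℚ`). -/
def lineInputQ : Matrix (Fin 4) ((Fin 4 × Fin 4) ⊕ (Fin 4 × Fin 4)) ℚ :=
  Matrix.of fun i k =>
    Sum.elim
      (fun k : Fin 4 × Fin 4 =>
        (if k.1 = i then (if k.1 < k.2 then Kundur2A.csgPre.Cc k.1 k.2 * MinvQ i else 0) else 0)
          - (if k.2 = i then (if k.1 < k.2 then Kundur2A.csgPre.Cc k.2 k.1 * MinvQ i else 0) else 0))
      (fun k : Fin 4 × Fin 4 =>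
        (if k.1 = i then (if k.1 < k.2 then Kundur2A.csgPre.Dc k.1 k.2 * MinvQ i else 0) else 0)
          + (if k.2 = i then (if k.1 < k.2 then Kundur2A.csgPre.Dc k.2 k.1 * MinvQ i else 0) else 0))
      k

/-- `B = [lineInput; 0]` over `ℚ`. -/
def BLQ : Matrix (Fin 4 ⊕ Fin 3) ((Fin 4 × Fin 4) ⊕ (Fin 4 × Fin 4)) ℚ := Matrix.fromRows lineInputQ 0

/-- The ordered-pair incidence over `ℚ`. -/
def pairIncQ : Matrix (Fin 4 × Fin 4) (Fin 3) ℚ :=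
  Matrix.of fun k a => (if k.1 = a.succ then 1 else 0) - (if k.2 = a.succ then 1 else 0)

/-- `C = [0 | pairIncidence; pairIncidence]` over `ℚ`. -/
def CQ : Matrix ((Fin 4 × Fin 4) ⊕ (Fin 4 × Fin 4)) (Fin 4 ⊕ Fin 3) ℚ := Matrix.fromCols 0 (Matrix.fromRows pairIncQ pairIncQ)


/-! ### The object `Kundur2A.splitLurieLinesSystem`: its matrices are the casts -/

/-- The record's inertias are the unit (scaled time; kernel). -/
private theorem csgPre_M_one : ∀ i : Fin 4, Kundur2A.csgPre.M i = 1 := by decide +kernel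

/-- `toLitNode.M = 1`. -/
private theorem tM' (i : Fin 4) : (Kundur2A.csgPre.toModelRel (1 / 10) 0).toLitNode.M i = 1 := by
  rw [ClassicalSwing.toLitNode_M]
  show ((Kundur2A.csgPre.M i : ℚ) : ℝ) = 1
  rw [csgPre_M_one i]; norm_num

/-- `toLitNode.D = (1/10)·M` (the declared uniform damping). -/
private theorem tD' (i : Fin 4) : (Kundur2A.csgPre.toModelRel (1 / 10) 0).toLitNode.D i = ((1 / 10 : ℚ) : ℝ) * ((Kundur2A.csgPre.M i : ℚ) : ℝ) := rfl

/-- `D_i/M_i = 1/10` on the litnode of the uniform-damping reading (plumbing). -/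
private theorem tDM' (i : Fin 4) :
    (Kundur2A.csgPre.toModelRel (1 / 10) 0).toLitNode.D i / (Kundur2A.csgPre.toModelRel (1 / 10) 0).toLitNode.M i = (((1 : ℚ) / 10 : ℚ) : ℝ) := by
  rw [tD', tM', csgPre_M_one i]; push_cast; ring

/-- `toLitNode.C p q = (Cc p q : ℝ)` — the sine weights are the typed rationals `E_pE_qB_pq`. -/
private theorem tC' (p q : Fin 4) :
    (Kundur2A.csgPre.toModelRel (1 / 10) 0).toLitNode.C p q = ((Kundur2A.csgPre.Cc p q : ℚ) : ℝ) := by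
  simp only [InternalNode.C, RecastData.Cc, Rat.cast_mul]; rfl

/-- `toLitNode.Dtr p q = (Dc p q : ℝ)` — the cosine weights are the typed rationals `E_pE_qG_pq`. -/
private theorem tDtr' (p q : Fin 4) :
    (Kundur2A.csgPre.toModelRel (1 / 10) 0).toLitNode.Dtr p q = ((Kundur2A.csgPre.Dc p q : ℚ) : ℝ) := by
  simp only [InternalNode.Dtr, RecastData.Dc, Rat.cast_mul]; rfl

/-- `S.A = AQ ↦ ℝ`. -/
theorem A_eq : Kundur2A.splitLurieLinesSystem.A = AQ.map (Rat.cast : ℚ → ℝ) := by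
  rw [Kundur2A.splitLurieLinesSystem_A]
  ext a b
  rcases a with i | m <;> rcases b with i' | m'
  · by_cases h : i = i'
    · subst h
      simp only [Matrix.fromBlocks_apply₁₁, Matrix.neg_apply, Matrix.diagonal_apply_eq, AQ, Matrix.map_apply, tDM']
      push_cast; norm_num
    · simp [Matrix.fromBlocks, AQ, Matrix.diagonal, h]
  · simp [Matrix.fromBlocks, AQ]
  · simp only [Matrix.fromBlocks_apply₂₁, InternalNode.refT, Matrix.of_apply, AQ, Matrix.map_apply]
    split_ifs <;> norm_num
  · simp [Matrix.fromBlocks, AQ]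

/-- `lineInput` of the instance is the cast of `lineInputQ`. -/
theorem lineInput_eq : (Kundur2A.csgPre.toModelRel (1 / 10) 0).toLitNode.lineInput = lineInputQ.map (Rat.cast : ℚ → ℝ) := by
  ext i k
  have hdiv : ∀ x : ℝ, x / (Kundur2A.csgPre.toModelRel (1 / 10) 0).toLitNode.M i = x * ((MinvQ i : ℚ) : ℝ) := by
    intro x; rw [tM', MinvQ, csgPre_M_one i]; norm_num
  rcases k with ⟨p, q⟩ | ⟨p, q⟩ <;>
    simp only [InternalNode.lineInput, lineInputQ, Matrix.of_apply, Sum.elim_inl, Sum.elim_inr,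
      Matrix.map_apply, tC', tDtr', hdiv] <;> split_ifs <;> push_cast <;> ring

/-- `S.B = BLQ ↦ ℝ` (RATIONAL). -/
theorem B_eq : Kundur2A.splitLurieLinesSystem.B = BLQ.map (Rat.cast : ℚ → ℝ) := by
  rw [Kundur2A.splitLurieLinesSystem_B, lineInput_eq]
  ext a k
  rcases a with i | m
  · simp [BLQ]
  · simp [BLQ]

/-- `S.C = CQ ↦ ℝ`. -/
theorem C_eq : Kundur2A.splitLurieLinesSystem.C = CQ.map (Rat.cast : ℚ → ℝ) := by
  rw [Kundur2A.splitLurieLinesSystem_C]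
  ext k b
  rcases b with i | m
  · rcases k with k | k <;> simp [CQ]
  · rcases k with k | k <;>
      simp only [Matrix.fromCols_apply_inr, Matrix.fromRows_apply_inl, Matrix.fromRows_apply_inr,
        InternalNode.pairIncidence, Matrix.of_apply, CQ, pairIncQ, Matrix.map_apply] <;>
      split_ifs <;> norm_num


/-! ### The wide-window sine sector lemma -/

/-- **Sine channel, WIDE window, closed form** (`|δ*| ≤ γ`: the window contains `ξ = 0`, where `cos` reaches `1`).
For `|δ*| < π/2`, `sin δ* = sd`, `cos δ* = cd`, a half-width `0 ≤ γ < π/2` with `cos γ = cg`, `sin γ = sg`: slopes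
`a ≤ cd·cg − |sd|·sg = cos(|δ*| + γ)` and `1 ≤ b` give the sector hypothesis on `|ξ − δ*| ≤ γ` (lit-6's
`channel_sector_sin`; companion of lyap-2's narrow-window `sector_sin_of_values`).
[cite: Pai1981, §4.6 p. 117; VuTuritsyn2017, §4.1 eq. (bound)] -/
theorem sector_sin_of_values_wide {δ γ sd cd cg sg al bu : ℝ} (hδ : |δ| < π / 2) (hγ0 : 0 ≤ γ) (hγ : γ < π / 2)
    (hs : Real.sin δ = sd) (hc : Real.cos δ = cd) (hcg : Real.cos γ = cg) (hsg : Real.sin γ = sg)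
    (ha : al ≤ cd * cg - |sd| * sg) (hb : 1 ≤ bu) :
    ∀ ξ, |ξ - δ| ≤ γ → al ≤ Real.cos ξ ∧ Real.cos ξ ≤ bu := by
  have hπ : |δ| + γ ≤ π := by linarith [abs_nonneg δ]
  have hcos_abs : Real.cos |δ| = cd := by rw [Real.cos_abs, hc]
  have hsin_abs : Real.sin |δ| = |sd| := by
    rcases le_or_gt 0 δ with h | h
    · have hδπ : δ ≤ π := by linarith [(abs_lt.1 hδ).2, Real.pi_pos]
      rw [abs_of_nonneg h, ← hs, abs_of_nonneg (Real.sin_nonneg_of_nonneg_of_le_pi h hδπ)]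
    · have hδπ : -π < δ := by linarith [(abs_lt.1 hδ).1, Real.pi_pos]
      rw [abs_of_neg h, Real.sin_neg, ← hs, abs_of_neg (Real.sin_neg_of_neg_of_neg_pi_lt h hδπ)]
  refine channel_sector_sin hπ ?_ hb
  rw [Real.cos_add, hcos_abs, hsin_abs, hcg, hsg]; exact ha


end Summit.Ventures.GridStability.Lyapunov.K2ALossySplitLines

end
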